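import Literature.AnabelianGeometry.SemiGraphs.GraphOfAnabelioids

/-!
# Base change of a semi-graph of anabelioids along a morphism of semi-graphs ([SemiAnbd] §2, pp. 22–24)

Mochizuki, *Semi-graphs of anabelioids*, Publ. RIMS **42** (2006) 221–322, §2
[cite: MochizukiSemiAnbd2006, Def. 2.1 pp.22-24].  For a semi-graph of anabelioids `𝒢` with
underlying semi-graph `𝔾` and a morphism of semi-graphs `ψ : 𝔾' → 𝔾`, the *base change*
`𝒢 ×_𝔾 𝔾'` is the semi-graph of anabelioids over `𝔾'` whose constituent at a component `c'` is
`𝒢_{ψ(c')}` and whose `b'_*` is `ψ(b')_*`; it comes with the tautological morphism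
`𝒢 ×_𝔾 𝔾' → 𝒢` over `ψ`, all of whose constituent morphisms are identities — a *locally trivial*
morphism in the sense of Definition 2.2 (ii) (p. 24).  This is the construction behind:

* p. 23 / Remark 2.2.1: a (finite) graph-covering `𝔾' → 𝔾` of the underlying semi-graph induces a
  finite étale covering of `𝒢` trivial over every constituent (used in the proof of Proposition 2.6,
  p. 29: "using the loop `L` … we may construct a finite graph-covering of degree `M` … which is
  trivial over `𝕂`, but connected over `L`");
* Remark 3.5.1 (p. 37): locally trivial morphisms ↔ graph-coverings with countable fibres;
* restriction to a sub-semi-graph (`SemiGraphOfAnabelioids.restrict`, p. 24) is the base change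
  along the inclusion `ℍ ↪ 𝔾` (`comap_ι_eq_restrict`).

Contents: `pullAt` / `transportHom` (transport of `b_*` and of constituents along equalities of
edges — the only bookkeeping, since `edgeOf (ψ b') = ψ (edgeOf b')` holds propositionally),
`comap ψ`, `comapHom ψ : Hom (𝒢.comap ψ) 𝒢`, and `comapHom_isLocallyTrivial`.

Deliberately NOT here: that `comapHom ψ` is a finite étale covering (Definition 2.2 (i)) when `ψ`
is a finite graph-covering — it needs `Coverticial.lean`'s `Hom.IsFiniteEtaleCoveringOf` and the
object `(∐_{fibre} 1, permutation gluings)` of `B(𝒢)`; companion file once that module is built.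
-/

namespace Literature.AnabelianGeometry.SemiGraphs

open CategoryTheory
open Literature.AnabelianGeometry.Anabelioids

universe v₁ u₁ u

namespace SemiGraphOfAnabelioids

variable (𝒢 : SemiGraphOfAnabelioids.{v₁, u₁, u})

/-! ### Transport along equalities of edges -/

/-- `b_* : 𝒢_e → 𝒢_v` for a branch `b` whose edge is *known* to be `e` (transport of `𝒢.pull`
along `edgeOf b = e`; needed because `edgeOf (ψ b') = ψ (edgeOf b')` holds only propositionally
for a morphism of semi-graphs `ψ`). [cite: MochizukiSemiAnbd2006, Def. 2.1 p.22] -/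
noncomputable def pullAt (b : 𝒢.graph.Branch) (v : 𝒢.graph.Vertex) (h : 𝒢.graph.abuts b = some v)
    (e : 𝒢.graph.Edge) (he : 𝒢.graph.edgeOf b = e) : Anabelioids.Hom (𝒢.E e) (𝒢.V v) := by
  subst he
  exact 𝒢.pull b v h

/-- `pullAt` at the reflexive equality is `pull`. [cite: MochizukiSemiAnbd2006, Def. 2.1 p.22] -/
@[simp] theorem pullAt_rfl (b : 𝒢.graph.Branch) (v : 𝒢.graph.Vertex)
    (h : 𝒢.graph.abuts b = some v) :
    𝒢.pullAt b v h (𝒢.graph.edgeOf b) rfl = 𝒢.pull b v h := rfl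

/-- The identity morphism `𝒢_e → 𝒢_f` of constituent anabelioids over equal edges `e = f`.
[cite: MochizukiSemiAnbd2006, Def. 2.1 p.22] -/
noncomputable def transportHom {e f : 𝒢.graph.Edge} (hf : e = f) :
    Anabelioids.Hom (𝒢.E e) (𝒢.E f) := by
  subst hf
  exact Anabelioids.Hom.id _

/-- `transportHom rfl` is the identity. [cite: MochizukiSemiAnbd2006, Def. 2.1 p.22] -/
@[simp] theorem transportHom_rfl (e : 𝒢.graph.Edge) :
    𝒢.transportHom (rfl : e = e) = Anabelioids.Hom.id _ := rfl

/-- The pull-back functor of `transportHom` is an equivalence (it is the identity).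
[cite: MochizukiSemiAnbd2006, Def. 2.1 p.22] -/
theorem transportHom_isIsomorphism {e f : 𝒢.graph.Edge} (hf : e = f) :
    (𝒢.transportHom hf).IsIsomorphism := by
  subst hf
  exact (inferInstance : (𝟭 (𝒢.E e)).IsEquivalence)

/-- The 2-isomorphism comparing "identity then transported `b_*`" with "`b_*` then transport":
both are `b^*` up to identity functors. [cite: MochizukiSemiAnbd2006, Def. 2.1 p.22] -/
noncomputable def pullAtIso (b : 𝒢.graph.Branch) (v : 𝒢.graph.Vertex)
    (h : 𝒢.graph.abuts b = some v) (e : 𝒢.graph.Edge) (he : 𝒢.graph.edgeOf b = e) :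
    (Anabelioids.Hom.id (𝒢.V v)).pullback ⋙ (𝒢.pullAt b v h e he).pullback ≅
      (𝒢.pull b v h).pullback ⋙ (𝒢.transportHom he.symm).pullback := by
  subst he
  exact (𝒢.pull b v h).pullback.leftUnitor ≪≫ ((𝒢.pull b v h).pullback.rightUnitor).symm

/-! ### Base change -/

variable {G' : SemiGraph.{u}} (ψ : G' ⟶ 𝒢.graph)

/-- **Base change** `𝒢 ×_𝔾 𝔾'` of a semi-graph of anabelioids `𝒢` along a morphism of semi-graphs
`ψ : 𝔾' → 𝔾`: underlying semi-graph `𝔾'`, constituents `𝒢_{ψ(v')}`, `𝒢_{ψ(e')}`, and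
`b'_* := ψ(b')_*` (p. 23: a graph-covering of `𝔾` induces a covering of `𝒢`; p. 24: restriction
to a sub-semi-graph). [cite: MochizukiSemiAnbd2006, Def. 2.1 pp.23-24] -/
noncomputable def comap : SemiGraphOfAnabelioids.{v₁, u₁, u} where
  graph := G'
  V v' := 𝒢.V (ψ.vertexMap v')
  E e' := 𝒢.E (ψ.edgeMap e')
  pull b' v' h' := 𝒢.pullAt (ψ.branchMap b') (ψ.vertexMap v') (ψ.abuts_branchMap b' v' h')
    (ψ.edgeMap (G'.edgeOf b')) (ψ.edgeOf_branchMap b')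

/-- The underlying semi-graph of the base change is `𝔾'`. [cite: MochizukiSemiAnbd2006, Def. 2.1 p.23] -/
@[simp] theorem comap_graph : (𝒢.comap ψ).graph = G' := rfl

/-- The vertex constituents of the base change. [cite: MochizukiSemiAnbd2006, Def. 2.1 p.23] -/
@[simp] theorem comap_V (v' : G'.Vertex) : (𝒢.comap ψ).V v' = 𝒢.V (ψ.vertexMap v') := rfl

/-- The edge constituents of the base change. [cite: MochizukiSemiAnbd2006, Def. 2.1 p.23] -/
@[simp] theorem comap_E (e' : G'.Edge) : (𝒢.comap ψ).E e' = 𝒢.E (ψ.edgeMap e') := rfl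

/-- The `b'_*` of the base change is the transported `ψ(b')_*`.
[cite: MochizukiSemiAnbd2006, Def. 2.1 p.23] -/
theorem comap_pull (b' : G'.Branch) (v' : G'.Vertex) (h' : G'.abuts b' = some v') :
    (𝒢.comap ψ).pull b' v' h' = 𝒢.pullAt (ψ.branchMap b') (ψ.vertexMap v')
      (ψ.abuts_branchMap b' v' h') (ψ.edgeMap (G'.edgeOf b')) (ψ.edgeOf_branchMap b') := rfl

/-- The tautological morphism `𝒢 ×_𝔾 𝔾' → 𝒢` over `ψ`: identity on every constituent, the
2-isomorphisms `φ_b` being the transport isomorphisms `pullAtIso`.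
[cite: MochizukiSemiAnbd2006, Def. 2.1 pp.23-24] -/
noncomputable def comapHom : Hom (𝒢.comap ψ) 𝒢 where
  base := ψ
  φV v' := Anabelioids.Hom.id (𝒢.V (ψ.vertexMap v'))
  φE _ _ hf := 𝒢.transportHom hf
  φB b' v' h' := 𝒢.pullAtIso (ψ.branchMap b') (ψ.vertexMap v') (ψ.abuts_branchMap b' v' h')
    (ψ.edgeMap (G'.edgeOf b')) (ψ.edgeOf_branchMap b')

/-- The tautological morphism lies over `ψ`. [cite: MochizukiSemiAnbd2006, Def. 2.1 p.23] -/
@[simp] theorem comapHom_base : (𝒢.comapHom ψ).base = ψ := rfl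

/-- The vertex components of the tautological morphism are identities.
[cite: MochizukiSemiAnbd2006, Def. 2.1 p.23] -/
@[simp] theorem comapHom_φV (v' : G'.Vertex) :
    (𝒢.comapHom ψ).φV v' = Anabelioids.Hom.id (𝒢.V (ψ.vertexMap v')) := rfl

/-- The edge components of the tautological morphism are the transport identities.
[cite: MochizukiSemiAnbd2006, Def. 2.1 p.23] -/
@[simp] theorem comapHom_φE (e' : G'.Edge) (f : 𝒢.graph.Edge) (hf : ψ.edgeMap e' = f) :
    (𝒢.comapHom ψ).φE e' f hf = 𝒢.transportHom hf := rfl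

/-- **The tautological morphism `𝒢 ×_𝔾 𝔾' → 𝒢` is locally trivial** ([SemiAnbd] Def. 2.2 (ii),
p. 24: "each of its induced morphisms between constituent anabelioids is an isomorphism").
[cite: MochizukiSemiAnbd2006, Def. 2.2(ii) p.24] -/
theorem comapHom_isLocallyTrivial : (𝒢.comapHom ψ).IsLocallyTrivial := by
  constructor
  · intro v'
    exact (inferInstance : (𝟭 (𝒢.V (ψ.vertexMap v'))).IsEquivalence)
  · intro e'
    exact 𝒢.transportHom_isIsomorphism rfl

/-! ### Restriction to a sub-semi-graph is base change along the inclusion -/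

/-- Restriction of `𝒢` to a sub-semi-graph `ℍ ⊆ 𝔾` (p. 24, `SemiGraphOfAnabelioids.restrict`) is the
base change along the inclusion `ℍ ↪ 𝔾`. [cite: MochizukiSemiAnbd2006, Def. 2.1 p.24] -/
theorem comap_ι_eq_restrict (H : 𝒢.graph.Subgraph) : 𝒢.comap H.ι = 𝒢.restrict H := rfl

end SemiGraphOfAnabelioids

end Literature.AnabelianGeometry.SemiGraphs
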